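import Mathlib

/-!
# A kernel-checked witness: Harris for the other root's connections does NOT survive the conditioning
«`a₁ ↔ v` and `a₁ ↮ {a₂, o, b}`» — the two-path mechanism (blind cell PercRepro2, night-1 g30;
proofs/NIGHT1-G30.md §2)

Under `Q = {a₁ ↮ a₂}` and the avoidance `a₁ ↮ {o, b}`, the events `{b ↔ a₂}`, `{o ↔ a₂}` are
positively correlated (explore `C(a₁)`, Harris on the complement, BHK06 Thm 1.3 for the antitone
complement functionals).  Conditioning in addition on a CONNECTION `a₁ ↔ v` of the root to an unmarked
vertex `v` — the cell `{v ∈ C₁, o ∉ C₁, b ∉ C₁}` of the trace decomposition of the first-order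
(MEANS-a₃) functional (FM) — destroys it: this file checks in the kernel, on a self-contained integer
model (the pattern of ChordOWitness.lean), the instance

  vertices `a₁ = 0, v = 1, u₁ = 2, u₂ = 3, a₂ = 4, b = 5, o = 6`;
  edges `a₁–u₁, u₁–v, a₁–u₂, u₂–v` (two disjoint `a₁`–`v` paths), `a₂–u₁, b–u₁, a₂–u₂, o–u₂`,
  every weight `1/2` (so every configuration has weight `1` in units of `2⁻⁸`).

Given the cell, `{b ↔ a₂}` forces `u₁ ∉ C(a₁)` (the `a₁`–`v` connection runs through `u₂`) and
`{o ↔ a₂}` forces `u₂ ∉ C(a₁)` — mutually exclusive.  The atoms `[M, H_b, H_o, H_bH_o]`, sums over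
the `2⁸` configurations with the clusters of `a₁`, `a₂` computed by eight expansion steps, are
`[13, 1, 1, 0]` by `decide` (kernel evaluation), so the cleared covariance `M·H_bH_o − H_b·H_o = −1 < 0`
(`P(H_b H_o ∣ cell) = 0 < (1/13)² = P(H_b ∣ cell)·P(H_o ∣ cell)`).  This is van den Berg–Kahn's
«false with `s ↔ t` in place of `s ↮ t`» mechanism (Ann. Probab. 29 (2001), the remark after Thm 1.1)
transported to the complement events; it kills the L-cell lemma (WS-L) of the trace decomposition and
the general statement (HARRIS-UP) «given `S ⊆ C(s)` and `s ↮ X`, connection events among `X` are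
positively correlated» (NIGHT1-G30.md §2).  Own code (harris_up_cex.py / wsl_cex.py, exact, two
paths); the model is not the tree's `prob` (no bridge is claimed).  Standard axioms.
-/

namespace Summit.Ventures.PercRepro2.TwoPathHarrisWitness

/-- The first endpoint of edge `i` (`i < 8`). -/
def eu : Nat → Nat
  | 0 => 0 | 1 => 2 | 2 => 0 | 3 => 3 | 4 => 4 | 5 => 5 | 6 => 4 | _ => 6

/-- The second endpoint of edge `i`. -/
def ev : Nat → Nat
  | 0 => 2 | 1 => 1 | 2 => 3 | 3 => 1 | 4 => 2 | 5 => 2 | 6 => 3 | _ => 3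

/-- Edge `i` is open in the configuration `c ∈ [0, 2⁸)` iff bit `i` of `c` is set. -/
def isOpen (c i : Nat) : Bool := c.testBit i

/-- Vertex sets are bitmasks over `0..6`. -/
def mem (S x : Nat) : Bool := S.testBit x

/-- One expansion step of a vertex set along the open edges. -/
def step (c S : Nat) : Nat :=
  (List.range 8).foldl (fun S i =>
    if isOpen c i && (mem S (eu i) || mem S (ev i)) then S ||| (1 <<< eu i) ||| (1 <<< ev i) else S) S

/-- `n`-fold iteration of `step c`. -/
def iter (c : Nat) : Nat → Nat → Nat
  | 0, S => S
  | n + 1, S => iter c n (step c S)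

/-- The open cluster of `x` (eight steps suffice on seven vertices). -/
def reach (c x : Nat) : Nat := iter c 8 (1 <<< x)

/-- The four atom contributions of the configuration `c` (weight `1` each, units of `2⁻⁸`):
`[M, H_b, H_o, H_bH_o]` on the cell `{a₁ ↮ a₂} ∩ {v ∈ C(a₁)} ∩ {o ∉ C(a₁)} ∩ {b ∉ C(a₁)}`
(`a₁ = 0`, `v = 1`, `a₂ = 4`, `b = 5`, `o = 6`), zero off the cell. -/
def contrib (c : Nat) : List Int :=
  let R1 := reach c 0
  let R2 := reach c 4
  if mem R1 4 || !(mem R1 1) || mem R1 6 || mem R1 5 then [0, 0, 0, 0] else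
  let Hb : Int := if mem R2 5 then 1 else 0
  let Ho : Int := if mem R2 6 then 1 else 0
  [1, Hb, Ho, Hb * Ho]

/-- Elementwise sum of two four-vectors. -/
def add4 (a b : List Int) : List Int := List.zipWith (· + ·) a b

/-- The four atoms, in units of `2⁻⁸`. -/
def atoms : List Int :=
  (List.range 256).foldl (fun acc c => add4 acc (contrib c)) [0, 0, 0, 0]

/-- The cleared covariance `M·H_bH_o − H_b·H_o`. -/
def covC (a : List Int) : Int :=
  match a with
  | [M, Hb, Ho, HbHo] => M * HbHo - Hb * Ho
  | _ => 0

/-- The atoms of the witness instance: `[13, 1, 1, 0]`. -/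
theorem atoms_eq : atoms = [13, 1, 1, 0] := by
  decide +kernel

/-- **The conditional Harris inequality fails**: `M·H_bH_o − H_b·H_o = −1 < 0`, i.e.
`P(b ↔ a₂, o ↔ a₂ ∣ cell) = 0 < P(b ↔ a₂ ∣ cell)·P(o ↔ a₂ ∣ cell)`. -/
theorem cond_harris_fails : covC atoms < 0 := by
  rw [atoms_eq]; decide

end Summit.Ventures.PercRepro2.TwoPathHarrisWitness
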